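import Mathlib.Data.Real.Basic
import Mathlib.Tactic
import HarnessLib

/-!
# `NoHeavyLowerTail` (crux stmt-CriticalPhenomena-4575), abstract sunflower cubic at LAW level: NESTED `PC* → PC*` PENCILS ARE LEMMA-A-ROBUST —
# `LA ≥ 0` at EVERY bias (hence (C1)) for every structure `[z=0: PC*(G); z=1: PC*(W)]`, `G_i ⊆ W_i` on disjoint blocks; a p-free family OUTSIDE the BK strata

Support file (seat `prim-ineq-gen-2` gen 32; `--supports stmt-CriticalPhenomena-4575`).  Nothing is asserted about the crux; no `sorry`, no named
facts, no definitions, standard axioms.  Memo: run/shared/lean/prim/prim-ineq-gen-2/CUBIC-SIGN-LAW-GEN32.md §2c (THEOREM 5).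

THE FAMILY.  Blocks `S₁,S₂,S₃`; on block `i` a configuration lies in `G_i` (mass `g_i`), in `W_i ∖ G_i` (`u_i`) or outside `W_i` (`v_i`) — up-sets
`G_i ⊆ W_i`, everything homogeneous in `g,u,v ≥ 0`.  The structure is `PC*(G₁,G₂,G₃)` for `z = 0` and `PC*(W₁,W₂,W₃)` for `z = 1` (monotone since
`G_i ⊆ W_i`); BOTH sections are A-tight (`LA = 0`).  Its law at bias `t` of `z` is `m_t = (1−t)·m*(g) + t·m*(w)`, `w = g + u`.  With 2-coin blocks
`G_i = {x_i ∧ y_i}`, `W_i = {x_i ∨ y_i}` (7 coins) the structure is bi-saturated and in NO BK stratum (gen-31 `bkA`/`bkB` tests all fail), yet: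

THEOREM (`nestedStar_LA_nonneg`, `nestedStar_C1`): **`LA(m_t) ≥ 0` for all `t ∈ [0,1]` and all `g,u,v ≥ 0`** — Lemma A with NO side condition —
and consequently (C1) (`a ≤ b ⟹ LB = LA + (b−a)·AG ≥ 0` as `AG ≥ 0`).  PROOF: `LA(m_t) = t(1−t)·((1−t)·β + t·M)` with `β = ⟨m*(w), ∇LA(m*(g))⟩`
and `M = ⟨m*(g), ∇LA(m*(w))⟩` (cubic expansion; both ends on the A-sheet), and β (81 monomials), M (275 monomials) have POSITIVE coefficients in
`g,u,v` (`star_beta_chunk*`, `star_M_chunk*`, identities `nestedStar_beta_eq`, `nestedStar_M_eq` by `ring`); `AG(m_t) = (1−t)²AG₀ + t(1−t)X + t²AG₁`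
with `AG₀, X, AG₁ ≥ 0` likewise.  Dually (complement duality) nested `PC → PC` pencils have `LB ≥ 0` everywhere.
-/

namespace Summit.CriticalPhenomena.PercolationContinuityZ3.Theorems.SunflowerPartition

namespace NestedStarPencil

section Cert

variable {g₁ g₂ g₃ u₁ u₂ u₃ v₁ v₂ v₃ : ℝ}

/-- Certificate piece `β`, chunk 1/3 (positive coefficients, hence `≥ 0`). [this work] -/
theorem star_beta_chunk1 (_hg₁ : 0 ≤ g₁) (_hg₂ : 0 ≤ g₂) (_hg₃ : 0 ≤ g₃) (_hu₁ : 0 ≤ u₁) (_hu₂ : 0 ≤ u₂) (_hu₃ : 0 ≤ u₃)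
    (_hv₁ : 0 ≤ v₁) (_hv₂ : 0 ≤ v₂) (_hv₃ : 0 ≤ v₃) :
    ∃ x : ℝ, 0 ≤ x ∧ x = g₁^3*g₂^2*g₃^2*u₂*u₃ + g₁^3*g₂^2*g₃*u₂*u₃^2 + g₁^3*g₂^2*g₃*u₂*u₃*v₃ + g₁^3*g₂*g₃^2*u₂^2*u₃ + g₁^3*g₂*g₃^2*u₂*u₃*v₂ + g₁^3*g₂*g₃*u₂^2*u₃^2 + g₁^3*g₂*g₃*u₂^2*u₃*v₃ + g₁^3*g₂*g₃*u₂*u₃^2*v₂ +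
        g₁^3*g₂*g₃*u₂*u₃*v₂*v₃ + g₁^2*g₂^3*g₃^2*u₁*u₃ + g₁^2*g₂^3*g₃*u₁*u₃^2 + g₁^2*g₂^3*g₃*u₁*u₃*v₃ + g₁^2*g₂^2*g₃^3*u₁*u₂ + 5*g₁^2*g₂^2*g₃^2*u₁*u₂*u₃ + g₁^2*g₂^2*g₃^2*u₁*u₂*v₃ +
        g₁^2*g₂^2*g₃^2*u₁*u₃*v₂ + g₁^2*g₂^2*g₃^2*u₂*u₃*v₁ + 4*g₁^2*g₂^2*g₃*u₁*u₂*u₃^2 + 4*g₁^2*g₂^2*g₃*u₁*u₂*u₃*v₃ + g₁^2*g₂^2*g₃*u₁*u₃^2*v₂ + g₁^2*g₂^2*g₃*u₁*u₃*v₂*v₃ + g₁^2*g₂^2*g₃*u₂*u₃^2*v₁ +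
        g₁^2*g₂^2*g₃*u₂*u₃*v₁*v₃ + g₁^2*g₂*g₃^3*u₁*u₂^2 + g₁^2*g₂*g₃^3*u₁*u₂*v₂ + 4*g₁^2*g₂*g₃^2*u₁*u₂^2*u₃ + g₁^2*g₂*g₃^2*u₁*u₂^2*v₃ + 4*g₁^2*g₂*g₃^2*u₁*u₂*u₃*v₂ + g₁^2*g₂*g₃^2*u₁*u₂*v₂*v₃ +
        g₁^2*g₂*g₃^2*u₂^2*u₃*v₁ + g₁^2*g₂*g₃^2*u₂*u₃*v₁*v₂ + 3*g₁^2*g₂*g₃*u₁*u₂^2*u₃^2 + 3*g₁^2*g₂*g₃*u₁*u₂^2*u₃*v₃ + 3*g₁^2*g₂*g₃*u₁*u₂*u₃^2*v₂ + 3*g₁^2*g₂*g₃*u₁*u₂*u₃*v₂*v₃ +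
        g₁^2*g₂*g₃*u₂^2*u₃^2*v₁ + g₁^2*g₂*g₃*u₂^2*u₃*v₁*v₃ + g₁^2*g₂*g₃*u₂*u₃^2*v₁*v₂ + g₁^2*g₂*g₃*u₂*u₃*v₁*v₂*v₃ + g₁*g₂^3*g₃^2*u₁^2*u₃ :=
  ⟨_, by positivity, rfl⟩

/-- Certificate piece `β`, chunk 2/3 (positive coefficients, hence `≥ 0`). [this work] -/
theorem star_beta_chunk2 (_hg₁ : 0 ≤ g₁) (_hg₂ : 0 ≤ g₂) (_hg₃ : 0 ≤ g₃) (_hu₁ : 0 ≤ u₁) (_hu₂ : 0 ≤ u₂) (_hu₃ : 0 ≤ u₃)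
    (_hv₁ : 0 ≤ v₁) (_hv₂ : 0 ≤ v₂) (_hv₃ : 0 ≤ v₃) :
    ∃ x : ℝ, 0 ≤ x ∧ x = g₁*g₂^3*g₃^2*u₁*u₃*v₁ + g₁*g₂^3*g₃*u₁^2*u₃^2 + g₁*g₂^3*g₃*u₁^2*u₃*v₃ + g₁*g₂^3*g₃*u₁*u₃^2*v₁ + g₁*g₂^3*g₃*u₁*u₃*v₁*v₃ + g₁*g₂^2*g₃^3*u₁^2*u₂ + g₁*g₂^2*g₃^3*u₁*u₂*v₁ +
        4*g₁*g₂^2*g₃^2*u₁^2*u₂*u₃ + g₁*g₂^2*g₃^2*u₁^2*u₂*v₃ + g₁*g₂^2*g₃^2*u₁^2*u₃*v₂ + 4*g₁*g₂^2*g₃^2*u₁*u₂*u₃*v₁ + g₁*g₂^2*g₃^2*u₁*u₂*v₁*v₃ + g₁*g₂^2*g₃^2*u₁*u₃*v₁*v₂ +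
        3*g₁*g₂^2*g₃*u₁^2*u₂*u₃^2 + 3*g₁*g₂^2*g₃*u₁^2*u₂*u₃*v₃ + g₁*g₂^2*g₃*u₁^2*u₃^2*v₂ + g₁*g₂^2*g₃*u₁^2*u₃*v₂*v₃ + 3*g₁*g₂^2*g₃*u₁*u₂*u₃^2*v₁ + 3*g₁*g₂^2*g₃*u₁*u₂*u₃*v₁*v₃ +
        g₁*g₂^2*g₃*u₁*u₃^2*v₁*v₂ + g₁*g₂^2*g₃*u₁*u₃*v₁*v₂*v₃ + g₁*g₂*g₃^3*u₁^2*u₂^2 + g₁*g₂*g₃^3*u₁^2*u₂*v₂ + g₁*g₂*g₃^3*u₁*u₂^2*v₁ + g₁*g₂*g₃^3*u₁*u₂*v₁*v₂ + 3*g₁*g₂*g₃^2*u₁^2*u₂^2*u₃ +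
        g₁*g₂*g₃^2*u₁^2*u₂^2*v₃ + 3*g₁*g₂*g₃^2*u₁^2*u₂*u₃*v₂ + g₁*g₂*g₃^2*u₁^2*u₂*v₂*v₃ + 3*g₁*g₂*g₃^2*u₁*u₂^2*u₃*v₁ + g₁*g₂*g₃^2*u₁*u₂^2*v₁*v₃ + 3*g₁*g₂*g₃^2*u₁*u₂*u₃*v₁*v₂ +
        g₁*g₂*g₃^2*u₁*u₂*v₁*v₂*v₃ + 2*g₁*g₂*g₃*u₁^2*u₂^2*u₃^2 + 2*g₁*g₂*g₃*u₁^2*u₂^2*u₃*v₃ + 2*g₁*g₂*g₃*u₁^2*u₂*u₃^2*v₂ + 2*g₁*g₂*g₃*u₁^2*u₂*u₃*v₂*v₃ + 2*g₁*g₂*g₃*u₁*u₂^2*u₃^2*v₁ +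
        2*g₁*g₂*g₃*u₁*u₂^2*u₃*v₁*v₃ + 2*g₁*g₂*g₃*u₁*u₂*u₃^2*v₁*v₂ :=
  ⟨_, by positivity, rfl⟩

/-- Certificate piece `β`, chunk 3/3 (positive coefficients, hence `≥ 0`). [this work] -/
theorem star_beta_chunk3 (_hg₁ : 0 ≤ g₁) (_hg₂ : 0 ≤ g₂) (_hg₃ : 0 ≤ g₃) (_hu₁ : 0 ≤ u₁) (_hu₂ : 0 ≤ u₂) (_hu₃ : 0 ≤ u₃)
    (_hv₁ : 0 ≤ v₁) (_hv₂ : 0 ≤ v₂) (_hv₃ : 0 ≤ v₃) :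
    ∃ x : ℝ, 0 ≤ x ∧ x = 2*g₁*g₂*g₃*u₁*u₂*u₃*v₁*v₂*v₃ :=
  ⟨_, by positivity, rfl⟩

/-- Certificate piece `M`, chunk 1/7 (positive coefficients, hence `≥ 0`). [this work] -/
theorem star_M_chunk1 (_hg₁ : 0 ≤ g₁) (_hg₂ : 0 ≤ g₂) (_hg₃ : 0 ≤ g₃) (_hu₁ : 0 ≤ u₁) (_hu₂ : 0 ≤ u₂) (_hu₃ : 0 ≤ u₃)
    (_hv₁ : 0 ≤ v₁) (_hv₂ : 0 ≤ v₂) (_hv₃ : 0 ≤ v₃) :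
    ∃ x : ℝ, 0 ≤ x ∧ x = g₁^3*g₂^2*g₃^2*u₂*u₃ + 2*g₁^3*g₂^2*g₃*u₂*u₃^2 + g₁^3*g₂^2*g₃*u₂*u₃*v₃ + g₁^3*g₂^2*u₂*u₃^3 + g₁^3*g₂^2*u₂*u₃^2*v₃ + 2*g₁^3*g₂*g₃^2*u₂^2*u₃ + g₁^3*g₂*g₃^2*u₂*u₃*v₂ + 4*g₁^3*g₂*g₃*u₂^2*u₃^2 +
        2*g₁^3*g₂*g₃*u₂^2*u₃*v₃ + 2*g₁^3*g₂*g₃*u₂*u₃^2*v₂ + g₁^3*g₂*g₃*u₂*u₃*v₂*v₃ + 2*g₁^3*g₂*u₂^2*u₃^3 + 2*g₁^3*g₂*u₂^2*u₃^2*v₃ + g₁^3*g₂*u₂*u₃^3*v₂ + g₁^3*g₂*u₂*u₃^2*v₂*v₃ +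
        g₁^3*g₃^2*u₂^3*u₃ + g₁^3*g₃^2*u₂^2*u₃*v₂ + 2*g₁^3*g₃*u₂^3*u₃^2 + g₁^3*g₃*u₂^3*u₃*v₃ + 2*g₁^3*g₃*u₂^2*u₃^2*v₂ + g₁^3*g₃*u₂^2*u₃*v₂*v₃ + g₁^3*u₂^3*u₃^3 + g₁^3*u₂^3*u₃^2*v₃ +
        g₁^3*u₂^2*u₃^3*v₂ + g₁^3*u₂^2*u₃^2*v₂*v₃ + g₁^2*g₂^3*g₃^2*u₁*u₃ + 2*g₁^2*g₂^3*g₃*u₁*u₃^2 + g₁^2*g₂^3*g₃*u₁*u₃*v₃ + g₁^2*g₂^3*u₁*u₃^3 + g₁^2*g₂^3*u₁*u₃^2*v₃ + g₁^2*g₂^2*g₃^3*u₁*u₂ +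
        7*g₁^2*g₂^2*g₃^2*u₁*u₂*u₃ + g₁^2*g₂^2*g₃^2*u₁*u₂*v₃ + g₁^2*g₂^2*g₃^2*u₁*u₃*v₂ + g₁^2*g₂^2*g₃^2*u₂*u₃*v₁ + 11*g₁^2*g₂^2*g₃*u₁*u₂*u₃^2 + 6*g₁^2*g₂^2*g₃*u₁*u₂*u₃*v₃ +
        2*g₁^2*g₂^2*g₃*u₁*u₃^2*v₂ + g₁^2*g₂^2*g₃*u₁*u₃*v₂*v₃ + 2*g₁^2*g₂^2*g₃*u₂*u₃^2*v₁ :=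
  ⟨_, by positivity, rfl⟩

/-- Certificate piece `M`, chunk 2/7 (positive coefficients, hence `≥ 0`). [this work] -/
theorem star_M_chunk2 (_hg₁ : 0 ≤ g₁) (_hg₂ : 0 ≤ g₂) (_hg₃ : 0 ≤ g₃) (_hu₁ : 0 ≤ u₁) (_hu₂ : 0 ≤ u₂) (_hu₃ : 0 ≤ u₃)
    (_hv₁ : 0 ≤ v₁) (_hv₂ : 0 ≤ v₂) (_hv₃ : 0 ≤ v₃) :
    ∃ x : ℝ, 0 ≤ x ∧ x = g₁^2*g₂^2*g₃*u₂*u₃*v₁*v₃ + 5*g₁^2*g₂^2*u₁*u₂*u₃^3 + 5*g₁^2*g₂^2*u₁*u₂*u₃^2*v₃ + g₁^2*g₂^2*u₁*u₃^3*v₂ + g₁^2*g₂^2*u₁*u₃^2*v₂*v₃ + g₁^2*g₂^2*u₂*u₃^3*v₁ + g₁^2*g₂^2*u₂*u₃^2*v₁*v₃ +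
        2*g₁^2*g₂*g₃^3*u₁*u₂^2 + g₁^2*g₂*g₃^3*u₁*u₂*v₂ + 11*g₁^2*g₂*g₃^2*u₁*u₂^2*u₃ + 2*g₁^2*g₂*g₃^2*u₁*u₂^2*v₃ + 6*g₁^2*g₂*g₃^2*u₁*u₂*u₃*v₂ + g₁^2*g₂*g₃^2*u₁*u₂*v₂*v₃ +
        2*g₁^2*g₂*g₃^2*u₂^2*u₃*v₁ + g₁^2*g₂*g₃^2*u₂*u₃*v₁*v₂ + 16*g₁^2*g₂*g₃*u₁*u₂^2*u₃^2 + 9*g₁^2*g₂*g₃*u₁*u₂^2*u₃*v₃ + 9*g₁^2*g₂*g₃*u₁*u₂*u₃^2*v₂ + 5*g₁^2*g₂*g₃*u₁*u₂*u₃*v₂*v₃ +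
        4*g₁^2*g₂*g₃*u₂^2*u₃^2*v₁ + 2*g₁^2*g₂*g₃*u₂^2*u₃*v₁*v₃ + 2*g₁^2*g₂*g₃*u₂*u₃^2*v₁*v₂ + g₁^2*g₂*g₃*u₂*u₃*v₁*v₂*v₃ + 7*g₁^2*g₂*u₁*u₂^2*u₃^3 + 7*g₁^2*g₂*u₁*u₂^2*u₃^2*v₃ +
        4*g₁^2*g₂*u₁*u₂*u₃^3*v₂ + 4*g₁^2*g₂*u₁*u₂*u₃^2*v₂*v₃ + 2*g₁^2*g₂*u₂^2*u₃^3*v₁ + 2*g₁^2*g₂*u₂^2*u₃^2*v₁*v₃ + g₁^2*g₂*u₂*u₃^3*v₁*v₂ + g₁^2*g₂*u₂*u₃^2*v₁*v₂*v₃ + g₁^2*g₃^3*u₁*u₂^3 +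
        g₁^2*g₃^3*u₁*u₂^2*v₂ + 5*g₁^2*g₃^2*u₁*u₂^3*u₃ + g₁^2*g₃^2*u₁*u₂^3*v₃ + 5*g₁^2*g₃^2*u₁*u₂^2*u₃*v₂ + g₁^2*g₃^2*u₁*u₂^2*v₂*v₃ + g₁^2*g₃^2*u₂^3*u₃*v₁ + g₁^2*g₃^2*u₂^2*u₃*v₁*v₂ +
        7*g₁^2*g₃*u₁*u₂^3*u₃^2 :=
  ⟨_, by positivity, rfl⟩

/-- Certificate piece `M`, chunk 3/7 (positive coefficients, hence `≥ 0`). [this work] -/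
theorem star_M_chunk3 (_hg₁ : 0 ≤ g₁) (_hg₂ : 0 ≤ g₂) (_hg₃ : 0 ≤ g₃) (_hu₁ : 0 ≤ u₁) (_hu₂ : 0 ≤ u₂) (_hu₃ : 0 ≤ u₃)
    (_hv₁ : 0 ≤ v₁) (_hv₂ : 0 ≤ v₂) (_hv₃ : 0 ≤ v₃) :
    ∃ x : ℝ, 0 ≤ x ∧ x = 4*g₁^2*g₃*u₁*u₂^3*u₃*v₃ + 7*g₁^2*g₃*u₁*u₂^2*u₃^2*v₂ + 4*g₁^2*g₃*u₁*u₂^2*u₃*v₂*v₃ + 2*g₁^2*g₃*u₂^3*u₃^2*v₁ + g₁^2*g₃*u₂^3*u₃*v₁*v₃ + 2*g₁^2*g₃*u₂^2*u₃^2*v₁*v₂ + g₁^2*g₃*u₂^2*u₃*v₁*v₂*v₃ +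
        3*g₁^2*u₁*u₂^3*u₃^3 + 3*g₁^2*u₁*u₂^3*u₃^2*v₃ + 3*g₁^2*u₁*u₂^2*u₃^3*v₂ + 3*g₁^2*u₁*u₂^2*u₃^2*v₂*v₃ + g₁^2*u₂^3*u₃^3*v₁ + g₁^2*u₂^3*u₃^2*v₁*v₃ + g₁^2*u₂^2*u₃^3*v₁*v₂ +
        g₁^2*u₂^2*u₃^2*v₁*v₂*v₃ + 2*g₁*g₂^3*g₃^2*u₁^2*u₃ + g₁*g₂^3*g₃^2*u₁*u₃*v₁ + 4*g₁*g₂^3*g₃*u₁^2*u₃^2 + 2*g₁*g₂^3*g₃*u₁^2*u₃*v₃ + 2*g₁*g₂^3*g₃*u₁*u₃^2*v₁ + g₁*g₂^3*g₃*u₁*u₃*v₁*v₃ +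
        2*g₁*g₂^3*u₁^2*u₃^3 + 2*g₁*g₂^3*u₁^2*u₃^2*v₃ + g₁*g₂^3*u₁*u₃^3*v₁ + g₁*g₂^3*u₁*u₃^2*v₁*v₃ + 2*g₁*g₂^2*g₃^3*u₁^2*u₂ + g₁*g₂^2*g₃^3*u₁*u₂*v₁ + 11*g₁*g₂^2*g₃^2*u₁^2*u₂*u₃ +
        2*g₁*g₂^2*g₃^2*u₁^2*u₂*v₃ + 2*g₁*g₂^2*g₃^2*u₁^2*u₃*v₂ + 6*g₁*g₂^2*g₃^2*u₁*u₂*u₃*v₁ + g₁*g₂^2*g₃^2*u₁*u₂*v₁*v₃ + g₁*g₂^2*g₃^2*u₁*u₃*v₁*v₂ + 16*g₁*g₂^2*g₃*u₁^2*u₂*u₃^2 +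
        9*g₁*g₂^2*g₃*u₁^2*u₂*u₃*v₃ + 4*g₁*g₂^2*g₃*u₁^2*u₃^2*v₂ + 2*g₁*g₂^2*g₃*u₁^2*u₃*v₂*v₃ + 9*g₁*g₂^2*g₃*u₁*u₂*u₃^2*v₁ + 5*g₁*g₂^2*g₃*u₁*u₂*u₃*v₁*v₃ + 2*g₁*g₂^2*g₃*u₁*u₃^2*v₁*v₂ :=
  ⟨_, by positivity, rfl⟩

/-- Certificate piece `M`, chunk 4/7 (positive coefficients, hence `≥ 0`). [this work] -/
theorem star_M_chunk4 (_hg₁ : 0 ≤ g₁) (_hg₂ : 0 ≤ g₂) (_hg₃ : 0 ≤ g₃) (_hu₁ : 0 ≤ u₁) (_hu₂ : 0 ≤ u₂) (_hu₃ : 0 ≤ u₃)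
    (_hv₁ : 0 ≤ v₁) (_hv₂ : 0 ≤ v₂) (_hv₃ : 0 ≤ v₃) :
    ∃ x : ℝ, 0 ≤ x ∧ x = g₁*g₂^2*g₃*u₁*u₃*v₁*v₂*v₃ + 7*g₁*g₂^2*u₁^2*u₂*u₃^3 + 7*g₁*g₂^2*u₁^2*u₂*u₃^2*v₃ + 2*g₁*g₂^2*u₁^2*u₃^3*v₂ + 2*g₁*g₂^2*u₁^2*u₃^2*v₂*v₃ + 4*g₁*g₂^2*u₁*u₂*u₃^3*v₁ + 4*g₁*g₂^2*u₁*u₂*u₃^2*v₁*v₃ +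
        g₁*g₂^2*u₁*u₃^3*v₁*v₂ + g₁*g₂^2*u₁*u₃^2*v₁*v₂*v₃ + 4*g₁*g₂*g₃^3*u₁^2*u₂^2 + 2*g₁*g₂*g₃^3*u₁^2*u₂*v₂ + 2*g₁*g₂*g₃^3*u₁*u₂^2*v₁ + g₁*g₂*g₃^3*u₁*u₂*v₁*v₂ + 16*g₁*g₂*g₃^2*u₁^2*u₂^2*u₃ +
        4*g₁*g₂*g₃^2*u₁^2*u₂^2*v₃ + 9*g₁*g₂*g₃^2*u₁^2*u₂*u₃*v₂ + 2*g₁*g₂*g₃^2*u₁^2*u₂*v₂*v₃ + 9*g₁*g₂*g₃^2*u₁*u₂^2*u₃*v₁ + 2*g₁*g₂*g₃^2*u₁*u₂^2*v₁*v₃ + 5*g₁*g₂*g₃^2*u₁*u₂*u₃*v₁*v₂ +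
        g₁*g₂*g₃^2*u₁*u₂*v₁*v₂*v₃ + 20*g₁*g₂*g₃*u₁^2*u₂^2*u₃^2 + 12*g₁*g₂*g₃*u₁^2*u₂^2*u₃*v₃ + 12*g₁*g₂*g₃*u₁^2*u₂*u₃^2*v₂ + 7*g₁*g₂*g₃*u₁^2*u₂*u₃*v₂*v₃ + 12*g₁*g₂*g₃*u₁*u₂^2*u₃^2*v₁ +
        7*g₁*g₂*g₃*u₁*u₂^2*u₃*v₁*v₃ + 7*g₁*g₂*g₃*u₁*u₂*u₃^2*v₁*v₂ + 4*g₁*g₂*g₃*u₁*u₂*u₃*v₁*v₂*v₃ + 8*g₁*g₂*u₁^2*u₂^2*u₃^3 + 8*g₁*g₂*u₁^2*u₂^2*u₃^2*v₃ + 5*g₁*g₂*u₁^2*u₂*u₃^3*v₂ +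
        5*g₁*g₂*u₁^2*u₂*u₃^2*v₂*v₃ + 5*g₁*g₂*u₁*u₂^2*u₃^3*v₁ + 5*g₁*g₂*u₁*u₂^2*u₃^2*v₁*v₃ + 3*g₁*g₂*u₁*u₂*u₃^3*v₁*v₂ + 3*g₁*g₂*u₁*u₂*u₃^2*v₁*v₂*v₃ + 2*g₁*g₃^3*u₁^2*u₂^3 + 2*g₁*g₃^3*u₁^2*u₂^2*v₂ +
        g₁*g₃^3*u₁*u₂^3*v₁ :=
  ⟨_, by positivity, rfl⟩

/-- Certificate piece `M`, chunk 5/7 (positive coefficients, hence `≥ 0`). [this work] -/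
theorem star_M_chunk5 (_hg₁ : 0 ≤ g₁) (_hg₂ : 0 ≤ g₂) (_hg₃ : 0 ≤ g₃) (_hu₁ : 0 ≤ u₁) (_hu₂ : 0 ≤ u₂) (_hu₃ : 0 ≤ u₃)
    (_hv₁ : 0 ≤ v₁) (_hv₂ : 0 ≤ v₂) (_hv₃ : 0 ≤ v₃) :
    ∃ x : ℝ, 0 ≤ x ∧ x = g₁*g₃^3*u₁*u₂^2*v₁*v₂ + 7*g₁*g₃^2*u₁^2*u₂^3*u₃ + 2*g₁*g₃^2*u₁^2*u₂^3*v₃ + 7*g₁*g₃^2*u₁^2*u₂^2*u₃*v₂ + 2*g₁*g₃^2*u₁^2*u₂^2*v₂*v₃ + 4*g₁*g₃^2*u₁*u₂^3*u₃*v₁ + g₁*g₃^2*u₁*u₂^3*v₁*v₃ +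
        4*g₁*g₃^2*u₁*u₂^2*u₃*v₁*v₂ + g₁*g₃^2*u₁*u₂^2*v₁*v₂*v₃ + 8*g₁*g₃*u₁^2*u₂^3*u₃^2 + 5*g₁*g₃*u₁^2*u₂^3*u₃*v₃ + 8*g₁*g₃*u₁^2*u₂^2*u₃^2*v₂ + 5*g₁*g₃*u₁^2*u₂^2*u₃*v₂*v₃ +
        5*g₁*g₃*u₁*u₂^3*u₃^2*v₁ + 3*g₁*g₃*u₁*u₂^3*u₃*v₁*v₃ + 5*g₁*g₃*u₁*u₂^2*u₃^2*v₁*v₂ + 3*g₁*g₃*u₁*u₂^2*u₃*v₁*v₂*v₃ + 3*g₁*u₁^2*u₂^3*u₃^3 + 3*g₁*u₁^2*u₂^3*u₃^2*v₃ + 3*g₁*u₁^2*u₂^2*u₃^3*v₂ +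
        3*g₁*u₁^2*u₂^2*u₃^2*v₂*v₃ + 2*g₁*u₁*u₂^3*u₃^3*v₁ + 2*g₁*u₁*u₂^3*u₃^2*v₁*v₃ + 2*g₁*u₁*u₂^2*u₃^3*v₁*v₂ + 2*g₁*u₁*u₂^2*u₃^2*v₁*v₂*v₃ + g₂^3*g₃^2*u₁^3*u₃ + g₂^3*g₃^2*u₁^2*u₃*v₁ +
        2*g₂^3*g₃*u₁^3*u₃^2 + g₂^3*g₃*u₁^3*u₃*v₃ + 2*g₂^3*g₃*u₁^2*u₃^2*v₁ + g₂^3*g₃*u₁^2*u₃*v₁*v₃ + g₂^3*u₁^3*u₃^3 + g₂^3*u₁^3*u₃^2*v₃ + g₂^3*u₁^2*u₃^3*v₁ + g₂^3*u₁^2*u₃^2*v₁*v₃ +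
        g₂^2*g₃^3*u₁^3*u₂ + g₂^2*g₃^3*u₁^2*u₂*v₁ + 5*g₂^2*g₃^2*u₁^3*u₂*u₃ + g₂^2*g₃^2*u₁^3*u₂*v₃ + g₂^2*g₃^2*u₁^3*u₃*v₂ :=
  ⟨_, by positivity, rfl⟩

/-- Certificate piece `M`, chunk 6/7 (positive coefficients, hence `≥ 0`). [this work] -/
theorem star_M_chunk6 (_hg₁ : 0 ≤ g₁) (_hg₂ : 0 ≤ g₂) (_hg₃ : 0 ≤ g₃) (_hu₁ : 0 ≤ u₁) (_hu₂ : 0 ≤ u₂) (_hu₃ : 0 ≤ u₃)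
    (_hv₁ : 0 ≤ v₁) (_hv₂ : 0 ≤ v₂) (_hv₃ : 0 ≤ v₃) :
    ∃ x : ℝ, 0 ≤ x ∧ x = 5*g₂^2*g₃^2*u₁^2*u₂*u₃*v₁ + g₂^2*g₃^2*u₁^2*u₂*v₁*v₃ + g₂^2*g₃^2*u₁^2*u₃*v₁*v₂ + 7*g₂^2*g₃*u₁^3*u₂*u₃^2 + 4*g₂^2*g₃*u₁^3*u₂*u₃*v₃ + 2*g₂^2*g₃*u₁^3*u₃^2*v₂ + g₂^2*g₃*u₁^3*u₃*v₂*v₃ +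
        7*g₂^2*g₃*u₁^2*u₂*u₃^2*v₁ + 4*g₂^2*g₃*u₁^2*u₂*u₃*v₁*v₃ + 2*g₂^2*g₃*u₁^2*u₃^2*v₁*v₂ + g₂^2*g₃*u₁^2*u₃*v₁*v₂*v₃ + 3*g₂^2*u₁^3*u₂*u₃^3 + 3*g₂^2*u₁^3*u₂*u₃^2*v₃ + g₂^2*u₁^3*u₃^3*v₂ +
        g₂^2*u₁^3*u₃^2*v₂*v₃ + 3*g₂^2*u₁^2*u₂*u₃^3*v₁ + 3*g₂^2*u₁^2*u₂*u₃^2*v₁*v₃ + g₂^2*u₁^2*u₃^3*v₁*v₂ + g₂^2*u₁^2*u₃^2*v₁*v₂*v₃ + 2*g₂*g₃^3*u₁^3*u₂^2 + g₂*g₃^3*u₁^3*u₂*v₂ +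
        2*g₂*g₃^3*u₁^2*u₂^2*v₁ + g₂*g₃^3*u₁^2*u₂*v₁*v₂ + 7*g₂*g₃^2*u₁^3*u₂^2*u₃ + 2*g₂*g₃^2*u₁^3*u₂^2*v₃ + 4*g₂*g₃^2*u₁^3*u₂*u₃*v₂ + g₂*g₃^2*u₁^3*u₂*v₂*v₃ + 7*g₂*g₃^2*u₁^2*u₂^2*u₃*v₁ +
        2*g₂*g₃^2*u₁^2*u₂^2*v₁*v₃ + 4*g₂*g₃^2*u₁^2*u₂*u₃*v₁*v₂ + g₂*g₃^2*u₁^2*u₂*v₁*v₂*v₃ + 8*g₂*g₃*u₁^3*u₂^2*u₃^2 + 5*g₂*g₃*u₁^3*u₂^2*u₃*v₃ + 5*g₂*g₃*u₁^3*u₂*u₃^2*v₂ + 3*g₂*g₃*u₁^3*u₂*u₃*v₂*v₃ +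
        8*g₂*g₃*u₁^2*u₂^2*u₃^2*v₁ + 5*g₂*g₃*u₁^2*u₂^2*u₃*v₁*v₃ + 5*g₂*g₃*u₁^2*u₂*u₃^2*v₁*v₂ + 3*g₂*g₃*u₁^2*u₂*u₃*v₁*v₂*v₃ + 3*g₂*u₁^3*u₂^2*u₃^3 :=
  ⟨_, by positivity, rfl⟩

/-- Certificate piece `M`, chunk 7/7 (positive coefficients, hence `≥ 0`). [this work] -/
theorem star_M_chunk7 (_hg₁ : 0 ≤ g₁) (_hg₂ : 0 ≤ g₂) (_hg₃ : 0 ≤ g₃) (_hu₁ : 0 ≤ u₁) (_hu₂ : 0 ≤ u₂) (_hu₃ : 0 ≤ u₃)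
    (_hv₁ : 0 ≤ v₁) (_hv₂ : 0 ≤ v₂) (_hv₃ : 0 ≤ v₃) :
    ∃ x : ℝ, 0 ≤ x ∧ x = 3*g₂*u₁^3*u₂^2*u₃^2*v₃ + 2*g₂*u₁^3*u₂*u₃^3*v₂ + 2*g₂*u₁^3*u₂*u₃^2*v₂*v₃ + 3*g₂*u₁^2*u₂^2*u₃^3*v₁ + 3*g₂*u₁^2*u₂^2*u₃^2*v₁*v₃ + 2*g₂*u₁^2*u₂*u₃^3*v₁*v₂ + 2*g₂*u₁^2*u₂*u₃^2*v₁*v₂*v₃ +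
        g₃^3*u₁^3*u₂^3 + g₃^3*u₁^3*u₂^2*v₂ + g₃^3*u₁^2*u₂^3*v₁ + g₃^3*u₁^2*u₂^2*v₁*v₂ + 3*g₃^2*u₁^3*u₂^3*u₃ + g₃^2*u₁^3*u₂^3*v₃ + 3*g₃^2*u₁^3*u₂^2*u₃*v₂ + g₃^2*u₁^3*u₂^2*v₂*v₃ +
        3*g₃^2*u₁^2*u₂^3*u₃*v₁ + g₃^2*u₁^2*u₂^3*v₁*v₃ + 3*g₃^2*u₁^2*u₂^2*u₃*v₁*v₂ + g₃^2*u₁^2*u₂^2*v₁*v₂*v₃ + 3*g₃*u₁^3*u₂^3*u₃^2 + 2*g₃*u₁^3*u₂^3*u₃*v₃ + 3*g₃*u₁^3*u₂^2*u₃^2*v₂ +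
        2*g₃*u₁^3*u₂^2*u₃*v₂*v₃ + 3*g₃*u₁^2*u₂^3*u₃^2*v₁ + 2*g₃*u₁^2*u₂^3*u₃*v₁*v₃ + 3*g₃*u₁^2*u₂^2*u₃^2*v₁*v₂ + 2*g₃*u₁^2*u₂^2*u₃*v₁*v₂*v₃ + u₁^3*u₂^3*u₃^3 + u₁^3*u₂^3*u₃^2*v₃ +
        u₁^3*u₂^2*u₃^3*v₂ + u₁^3*u₂^2*u₃^2*v₂*v₃ + u₁^2*u₂^3*u₃^3*v₁ + u₁^2*u₂^3*u₃^2*v₁*v₃ + u₁^2*u₂^2*u₃^3*v₁*v₂ + u₁^2*u₂^2*u₃^2*v₁*v₂*v₃ :=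
  ⟨_, by positivity, rfl⟩

/-- Certificate piece `X = ⟨m*(w), ∇AG(m*(g))⟩`, chunk 1/3 (positive coefficients, hence `≥ 0`). [this work] -/
theorem star_X_chunk1 (_hg₁ : 0 ≤ g₁) (_hg₂ : 0 ≤ g₂) (_hg₃ : 0 ≤ g₃) (_hu₁ : 0 ≤ u₁) (_hu₂ : 0 ≤ u₂) (_hu₃ : 0 ≤ u₃)
    (_hv₁ : 0 ≤ v₁) (_hv₂ : 0 ≤ v₂) (_hv₃ : 0 ≤ v₃) :
    ∃ x : ℝ, 0 ≤ x ∧ x = g₁^2*g₂*g₃*u₂*u₃ + g₁^2*g₂*u₂*u₃^2 + g₁^2*g₂*u₂*u₃*v₃ + g₁^2*g₃*u₂^2*u₃ + g₁^2*g₃*u₂*u₃*v₂ + g₁^2*u₂^2*u₃^2 + g₁^2*u₂^2*u₃*v₃ + g₁^2*u₂*u₃^2*v₂ + g₁^2*u₂*u₃*v₂*v₃ + g₁*g₂^2*g₃*u₁*u₃ +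
        g₁*g₂^2*u₁*u₃^2 + g₁*g₂^2*u₁*u₃*v₃ + g₁*g₂*g₃^2*u₁*u₂ + 4*g₁*g₂*g₃*u₁*u₂*u₃ + g₁*g₂*g₃*u₁*u₂*v₃ + g₁*g₂*g₃*u₁*u₃*v₂ + g₁*g₂*g₃*u₁*v₂*v₃ + g₁*g₂*g₃*u₂*u₃*v₁ + g₁*g₂*g₃*u₂*v₁*v₃ +
        g₁*g₂*g₃*u₃*v₁*v₂ + 2*g₁*g₂*g₃*v₁*v₂*v₃ + 3*g₁*g₂*u₁*u₂*u₃^2 + 3*g₁*g₂*u₁*u₂*u₃*v₃ + g₁*g₂*u₁*u₃^2*v₂ + g₁*g₂*u₁*u₃*v₂*v₃ + g₁*g₂*u₂*u₃^2*v₁ + g₁*g₂*u₂*u₃*v₁*v₃ + g₁*g₂*u₃^2*v₁*v₂ +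
        g₁*g₂*u₃*v₁*v₂*v₃ + g₁*g₃^2*u₁*u₂^2 + g₁*g₃^2*u₁*u₂*v₂ + 3*g₁*g₃*u₁*u₂^2*u₃ + g₁*g₃*u₁*u₂^2*v₃ + 3*g₁*g₃*u₁*u₂*u₃*v₂ + g₁*g₃*u₁*u₂*v₂*v₃ + g₁*g₃*u₂^2*u₃*v₁ + g₁*g₃*u₂^2*v₁*v₃ +
        g₁*g₃*u₂*u₃*v₁*v₂ + g₁*g₃*u₂*v₁*v₂*v₃ + 2*g₁*u₁*u₂^2*u₃^2 :=
  ⟨_, by positivity, rfl⟩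

/-- Certificate piece `X = ⟨m*(w), ∇AG(m*(g))⟩`, chunk 2/3 (positive coefficients, hence `≥ 0`). [this work] -/
theorem star_X_chunk2 (_hg₁ : 0 ≤ g₁) (_hg₂ : 0 ≤ g₂) (_hg₃ : 0 ≤ g₃) (_hu₁ : 0 ≤ u₁) (_hu₂ : 0 ≤ u₂) (_hu₃ : 0 ≤ u₃)
    (_hv₁ : 0 ≤ v₁) (_hv₂ : 0 ≤ v₂) (_hv₃ : 0 ≤ v₃) :
    ∃ x : ℝ, 0 ≤ x ∧ x = 2*g₁*u₁*u₂^2*u₃*v₃ + 2*g₁*u₁*u₂*u₃^2*v₂ + 2*g₁*u₁*u₂*u₃*v₂*v₃ + g₁*u₂^2*u₃^2*v₁ + g₁*u₂^2*u₃*v₁*v₃ + g₁*u₂*u₃^2*v₁*v₂ + g₁*u₂*u₃*v₁*v₂*v₃ + g₂^2*g₃*u₁^2*u₃ + g₂^2*g₃*u₁*u₃*v₁ +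
        g₂^2*u₁^2*u₃^2 + g₂^2*u₁^2*u₃*v₃ + g₂^2*u₁*u₃^2*v₁ + g₂^2*u₁*u₃*v₁*v₃ + g₂*g₃^2*u₁^2*u₂ + g₂*g₃^2*u₁*u₂*v₁ + 3*g₂*g₃*u₁^2*u₂*u₃ + g₂*g₃*u₁^2*u₂*v₃ + g₂*g₃*u₁^2*u₃*v₂ + g₂*g₃*u₁^2*v₂*v₃ +
        3*g₂*g₃*u₁*u₂*u₃*v₁ + g₂*g₃*u₁*u₂*v₁*v₃ + g₂*g₃*u₁*u₃*v₁*v₂ + g₂*g₃*u₁*v₁*v₂*v₃ + 2*g₂*u₁^2*u₂*u₃^2 + 2*g₂*u₁^2*u₂*u₃*v₃ + g₂*u₁^2*u₃^2*v₂ + g₂*u₁^2*u₃*v₂*v₃ + 2*g₂*u₁*u₂*u₃^2*v₁ +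
        2*g₂*u₁*u₂*u₃*v₁*v₃ + g₂*u₁*u₃^2*v₁*v₂ + g₂*u₁*u₃*v₁*v₂*v₃ + g₃^2*u₁^2*u₂^2 + g₃^2*u₁^2*u₂*v₂ + g₃^2*u₁*u₂^2*v₁ + g₃^2*u₁*u₂*v₁*v₂ + 2*g₃*u₁^2*u₂^2*u₃ + g₃*u₁^2*u₂^2*v₃ +
        2*g₃*u₁^2*u₂*u₃*v₂ + g₃*u₁^2*u₂*v₂*v₃ + 2*g₃*u₁*u₂^2*u₃*v₁ :=
  ⟨_, by positivity, rfl⟩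

/-- Certificate piece `X = ⟨m*(w), ∇AG(m*(g))⟩`, chunk 3/3 (positive coefficients, hence `≥ 0`). [this work] -/
theorem star_X_chunk3 (_hg₁ : 0 ≤ g₁) (_hg₂ : 0 ≤ g₂) (_hg₃ : 0 ≤ g₃) (_hu₁ : 0 ≤ u₁) (_hu₂ : 0 ≤ u₂) (_hu₃ : 0 ≤ u₃)
    (_hv₁ : 0 ≤ v₁) (_hv₂ : 0 ≤ v₂) (_hv₃ : 0 ≤ v₃) :
    ∃ x : ℝ, 0 ≤ x ∧ x = g₃*u₁*u₂^2*v₁*v₃ + 2*g₃*u₁*u₂*u₃*v₁*v₂ + g₃*u₁*u₂*v₁*v₂*v₃ + u₁^2*u₂^2*u₃^2 + u₁^2*u₂^2*u₃*v₃ + u₁^2*u₂*u₃^2*v₂ + u₁^2*u₂*u₃*v₂*v₃ + u₁*u₂^2*u₃^2*v₁ + u₁*u₂^2*u₃*v₁*v₃ + u₁*u₂*u₃^2*v₁*v₂ +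
        u₁*u₂*u₃*v₁*v₂*v₃ :=
  ⟨_, by positivity, rfl⟩

end Cert

section Pencil

variable {g₁ g₂ g₃ u₁ u₂ u₃ v₁ v₂ v₃ t a b c₁ c₂ c₃ as bs cs₁ cs₂ cs₃ aw bw cw₁ cw₂ cw₃ : ℝ}

/-- Cubic expansion of `LA` along the pencil between the two `PC*` laws (pure cell algebra). [this work] -/
theorem nestedStar_LA_expand
    (hb : b = (1-t)*bs + t*bw) (hc₁ : c₁ = (1-t)*cs₁ + t*cw₁) (hc₂ : c₂ = (1-t)*cs₂ + t*cw₂) (hc₃ : c₃ = (1-t)*cs₃ + t*cw₃)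
    (ha : a = (1-t)*as + t*aw) :
    a*(a*b - (c₁*c₂+c₁*c₃+c₂*c₃)) - c₁*c₂*c₃ =
      (1-t)^3 * (as*(as*bs - (cs₁*cs₂+cs₁*cs₃+cs₂*cs₃)) - cs₁*cs₂*cs₃) + (1-t)^2*t * (aw*(2*as*bs - (cs₁*cs₂+cs₁*cs₃+cs₂*cs₃)) + bw*as^2 - cw₁*(as*(cs₂+cs₃)+cs₂*cs₃) - cw₂*(as*(cs₁+cs₃)+cs₁*cs₃) - cw₃*(as*(cs₁+cs₂)+cs₁*cs₂)) + (1-t)*t^2 * (as*(2*aw*bw - (cw₁*cw₂+cw₁*cw₃+cw₂*cw₃)) + bs*aw^2 - cs₁*(aw*(cw₂+cw₃)+cw₂*cw₃) - cs₂*(aw*(cw₁+cw₃)+cw₁*cw₃) - cs₃*(aw*(cw₁+cw₂)+cw₁*cw₂)) + t^3 * (aw*(aw*bw - (cw₁*cw₂+cw₁*cw₃+cw₂*cw₃)) - cw₁*cw₂*cw₃) := by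
  rw [ha, hb, hc₁, hc₂, hc₃]; ring

/-- Quadratic expansion of `AG` along the pencil. [this work] -/
theorem nestedStar_AG_expand
    (hb : b = (1-t)*bs + t*bw) (hc₁ : c₁ = (1-t)*cs₁ + t*cw₁) (hc₂ : c₂ = (1-t)*cs₂ + t*cw₂) (hc₃ : c₃ = (1-t)*cs₃ + t*cw₃)
    (ha : a = (1-t)*as + t*aw) :
    a*b - (c₁*c₂+c₁*c₃+c₂*c₃) = (1-t)^2 * (as*bs - (cs₁*cs₂+cs₁*cs₃+cs₂*cs₃)) + (1-t)*t * (aw*bs + bw*as - cw₁*(cs₂+cs₃) - cw₂*(cs₁+cs₃) - cw₃*(cs₁+cs₂)) + t^2 * (aw*bw - (cw₁*cw₂+cw₁*cw₃+cw₂*cw₃)) := by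
  rw [ha, hb, hc₁, hc₂, hc₃]; ring

/-- Both ends are on the A-sheet, and `AG₀, AG₁` are explicit products. [this work] -/
theorem nestedStar_ends (has : as = g₁*g₂*g₃) (hcs₁ : cs₁ = g₂*g₃*(u₁+v₁)) (hcs₂ : cs₂ = g₁*g₃*(u₂+v₂)) (hcs₃ : cs₃ = g₁*g₂*(u₃+v₃))
    (hbs : bs = (g₁+u₁+v₁)*(g₂+u₂+v₂)*(g₃+u₃+v₃) - g₁*g₂*g₃ - g₂*g₃*(u₁+v₁) - g₁*g₃*(u₂+v₂) - g₁*g₂*(u₃+v₃))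
    (haw : aw = (g₁+u₁)*(g₂+u₂)*(g₃+u₃)) (hcw₁ : cw₁ = (g₂+u₂)*(g₃+u₃)*v₁) (hcw₂ : cw₂ = (g₁+u₁)*(g₃+u₃)*v₂) (hcw₃ : cw₃ = (g₁+u₁)*(g₂+u₂)*v₃)
    (hbw : bw = (g₁+u₁+v₁)*(g₂+u₂+v₂)*(g₃+u₃+v₃) - (g₁+u₁)*(g₂+u₂)*(g₃+u₃) - (g₂+u₂)*(g₃+u₃)*v₁ - (g₁+u₁)*(g₃+u₃)*v₂ - (g₁+u₁)*(g₂+u₂)*v₃) :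
    (as*(as*bs - (cs₁*cs₂+cs₁*cs₃+cs₂*cs₃)) - cs₁*cs₂*cs₃) = 0 ∧ (aw*(aw*bw - (cw₁*cw₂+cw₁*cw₃+cw₂*cw₃)) - cw₁*cw₂*cw₃) = 0 ∧ (as*bs - (cs₁*cs₂+cs₁*cs₃+cs₂*cs₃)) = g₁*g₂*g₃*((u₁+v₁)*(u₂+v₂)*(u₃+v₃)) ∧ (aw*bw - (cw₁*cw₂+cw₁*cw₃+cw₂*cw₃)) = (g₁+u₁)*(g₂+u₂)*(g₃+u₃)*(v₁*v₂*v₃) := by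
  refine ⟨?_, ?_, ?_, ?_⟩ <;> (simp only [has, hbs, hcs₁, hcs₂, hcs₃, haw, hbw, hcw₁, hcw₂, hcw₃]; ring)

/-- The mixed term `X = ⟨m*(w), ∇AG(m*(g))⟩` of `AG` along the pencil is a polynomial with positive coefficients (91 monomials). [this work] -/
theorem nestedStar_X_eq (hg₁ : 0 ≤ g₁) (hg₂ : 0 ≤ g₂) (hg₃ : 0 ≤ g₃) (hu₁ : 0 ≤ u₁) (hu₂ : 0 ≤ u₂) (hu₃ : 0 ≤ u₃)
    (hv₁ : 0 ≤ v₁) (hv₂ : 0 ≤ v₂) (hv₃ : 0 ≤ v₃)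
    (has : as = g₁*g₂*g₃) (hcs₁ : cs₁ = g₂*g₃*(u₁+v₁)) (hcs₂ : cs₂ = g₁*g₃*(u₂+v₂)) (hcs₃ : cs₃ = g₁*g₂*(u₃+v₃))
    (hbs : bs = (g₁+u₁+v₁)*(g₂+u₂+v₂)*(g₃+u₃+v₃) - g₁*g₂*g₃ - g₂*g₃*(u₁+v₁) - g₁*g₃*(u₂+v₂) - g₁*g₂*(u₃+v₃))
    (haw : aw = (g₁+u₁)*(g₂+u₂)*(g₃+u₃)) (hcw₁ : cw₁ = (g₂+u₂)*(g₃+u₃)*v₁) (hcw₂ : cw₂ = (g₁+u₁)*(g₃+u₃)*v₂) (hcw₃ : cw₃ = (g₁+u₁)*(g₂+u₂)*v₃)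
    (hbw : bw = (g₁+u₁+v₁)*(g₂+u₂+v₂)*(g₃+u₃+v₃) - (g₁+u₁)*(g₂+u₂)*(g₃+u₃) - (g₂+u₂)*(g₃+u₃)*v₁ - (g₁+u₁)*(g₃+u₃)*v₂ - (g₁+u₁)*(g₂+u₂)*v₃) :
    ∃ X : ℝ, 0 ≤ X ∧ (aw*bs + bw*as - cw₁*(cs₂+cs₃) - cw₂*(cs₁+cs₃) - cw₃*(cs₁+cs₂)) = X := by
  obtain ⟨x1, hx1, ex1⟩ := star_X_chunk1 hg₁ hg₂ hg₃ hu₁ hu₂ hu₃ hv₁ hv₂ hv₃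
  obtain ⟨x2, hx2, ex2⟩ := star_X_chunk2 hg₁ hg₂ hg₃ hu₁ hu₂ hu₃ hv₁ hv₂ hv₃
  obtain ⟨x3, hx3, ex3⟩ := star_X_chunk3 hg₁ hg₂ hg₃ hu₁ hu₂ hu₃ hv₁ hv₂ hv₃
  refine ⟨x1 + x2 + x3, by positivity, ?_⟩
  rw [ex1, ex2, ex3, has, hbs, hcs₁, hcs₂, hcs₃, haw, hbw, hcw₁, hcw₂, hcw₃]; ring

/-- `β = ⟨m*(w), ∇LA(m*(g))⟩` is a polynomial with positive coefficients (81 monomials), hence `≥ 0`. [this work] -/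
theorem nestedStar_beta_eq (hg₁ : 0 ≤ g₁) (hg₂ : 0 ≤ g₂) (hg₃ : 0 ≤ g₃) (hu₁ : 0 ≤ u₁) (hu₂ : 0 ≤ u₂) (hu₃ : 0 ≤ u₃)
    (hv₁ : 0 ≤ v₁) (hv₂ : 0 ≤ v₂) (hv₃ : 0 ≤ v₃)
    (has : as = g₁*g₂*g₃) (hcs₁ : cs₁ = g₂*g₃*(u₁+v₁)) (hcs₂ : cs₂ = g₁*g₃*(u₂+v₂)) (hcs₃ : cs₃ = g₁*g₂*(u₃+v₃))
    (hbs : bs = (g₁+u₁+v₁)*(g₂+u₂+v₂)*(g₃+u₃+v₃) - g₁*g₂*g₃ - g₂*g₃*(u₁+v₁) - g₁*g₃*(u₂+v₂) - g₁*g₂*(u₃+v₃))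
    (haw : aw = (g₁+u₁)*(g₂+u₂)*(g₃+u₃)) (hcw₁ : cw₁ = (g₂+u₂)*(g₃+u₃)*v₁) (hcw₂ : cw₂ = (g₁+u₁)*(g₃+u₃)*v₂) (hcw₃ : cw₃ = (g₁+u₁)*(g₂+u₂)*v₃)
    (hbw : bw = (g₁+u₁+v₁)*(g₂+u₂+v₂)*(g₃+u₃+v₃) - (g₁+u₁)*(g₂+u₂)*(g₃+u₃) - (g₂+u₂)*(g₃+u₃)*v₁ - (g₁+u₁)*(g₃+u₃)*v₂ - (g₁+u₁)*(g₂+u₂)*v₃) :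
    ∃ B : ℝ, 0 ≤ B ∧ (aw*(2*as*bs - (cs₁*cs₂+cs₁*cs₃+cs₂*cs₃)) + bw*as^2 - cw₁*(as*(cs₂+cs₃)+cs₂*cs₃) - cw₂*(as*(cs₁+cs₃)+cs₁*cs₃) - cw₃*(as*(cs₁+cs₂)+cs₁*cs₂)) = B := by
  obtain ⟨r1, hr1, er1⟩ := star_beta_chunk1 hg₁ hg₂ hg₃ hu₁ hu₂ hu₃ hv₁ hv₂ hv₃
  obtain ⟨r2, hr2, er2⟩ := star_beta_chunk2 hg₁ hg₂ hg₃ hu₁ hu₂ hu₃ hv₁ hv₂ hv₃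
  obtain ⟨r3, hr3, er3⟩ := star_beta_chunk3 hg₁ hg₂ hg₃ hu₁ hu₂ hu₃ hv₁ hv₂ hv₃
  refine ⟨r1 + r2 + r3, by positivity, ?_⟩
  rw [er1, er2, er3, has, hbs, hcs₁, hcs₂, hcs₃, haw, hbw, hcw₁, hcw₂, hcw₃]; ring

/-- `M = ⟨m*(g), ∇LA(m*(w))⟩` is a polynomial with positive coefficients (275 monomials), hence `≥ 0`. [this work] -/
theorem nestedStar_M_eq (hg₁ : 0 ≤ g₁) (hg₂ : 0 ≤ g₂) (hg₃ : 0 ≤ g₃) (hu₁ : 0 ≤ u₁) (hu₂ : 0 ≤ u₂) (hu₃ : 0 ≤ u₃)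
    (hv₁ : 0 ≤ v₁) (hv₂ : 0 ≤ v₂) (hv₃ : 0 ≤ v₃)
    (has : as = g₁*g₂*g₃) (hcs₁ : cs₁ = g₂*g₃*(u₁+v₁)) (hcs₂ : cs₂ = g₁*g₃*(u₂+v₂)) (hcs₃ : cs₃ = g₁*g₂*(u₃+v₃))
    (hbs : bs = (g₁+u₁+v₁)*(g₂+u₂+v₂)*(g₃+u₃+v₃) - g₁*g₂*g₃ - g₂*g₃*(u₁+v₁) - g₁*g₃*(u₂+v₂) - g₁*g₂*(u₃+v₃))
    (haw : aw = (g₁+u₁)*(g₂+u₂)*(g₃+u₃)) (hcw₁ : cw₁ = (g₂+u₂)*(g₃+u₃)*v₁) (hcw₂ : cw₂ = (g₁+u₁)*(g₃+u₃)*v₂) (hcw₃ : cw₃ = (g₁+u₁)*(g₂+u₂)*v₃)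
    (hbw : bw = (g₁+u₁+v₁)*(g₂+u₂+v₂)*(g₃+u₃+v₃) - (g₁+u₁)*(g₂+u₂)*(g₃+u₃) - (g₂+u₂)*(g₃+u₃)*v₁ - (g₁+u₁)*(g₃+u₃)*v₂ - (g₁+u₁)*(g₂+u₂)*v₃) :
    ∃ B : ℝ, 0 ≤ B ∧ (as*(2*aw*bw - (cw₁*cw₂+cw₁*cw₃+cw₂*cw₃)) + bs*aw^2 - cs₁*(aw*(cw₂+cw₃)+cw₂*cw₃) - cs₂*(aw*(cw₁+cw₃)+cw₁*cw₃) - cs₃*(aw*(cw₁+cw₂)+cw₁*cw₂)) = B := by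
  obtain ⟨q1, hq1, eq1⟩ := star_M_chunk1 hg₁ hg₂ hg₃ hu₁ hu₂ hu₃ hv₁ hv₂ hv₃
  obtain ⟨q2, hq2, eq2⟩ := star_M_chunk2 hg₁ hg₂ hg₃ hu₁ hu₂ hu₃ hv₁ hv₂ hv₃
  obtain ⟨q3, hq3, eq3⟩ := star_M_chunk3 hg₁ hg₂ hg₃ hu₁ hu₂ hu₃ hv₁ hv₂ hv₃
  obtain ⟨q4, hq4, eq4⟩ := star_M_chunk4 hg₁ hg₂ hg₃ hu₁ hu₂ hu₃ hv₁ hv₂ hv₃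
  obtain ⟨q5, hq5, eq5⟩ := star_M_chunk5 hg₁ hg₂ hg₃ hu₁ hu₂ hu₃ hv₁ hv₂ hv₃
  obtain ⟨q6, hq6, eq6⟩ := star_M_chunk6 hg₁ hg₂ hg₃ hu₁ hu₂ hu₃ hv₁ hv₂ hv₃
  obtain ⟨q7, hq7, eq7⟩ := star_M_chunk7 hg₁ hg₂ hg₃ hu₁ hu₂ hu₃ hv₁ hv₂ hv₃
  refine ⟨q1 + q2 + q3 + q4 + q5 + q6 + q7, by positivity, ?_⟩
  rw [eq1, eq2, eq3, eq4, eq5, eq6, eq7, has, hbs, hcs₁, hcs₂, hcs₃, haw, hbw, hcw₁, hcw₂, hcw₃]; ring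

/-- **Lemma A with no side condition on nested `PC* → PC*` pencils**: `LA(m_t) ≥ 0` for every `t ∈ [0,1]`. [this work] -/
theorem nestedStar_LA_nonneg (hg₁ : 0 ≤ g₁) (hg₂ : 0 ≤ g₂) (hg₃ : 0 ≤ g₃) (hu₁ : 0 ≤ u₁) (hu₂ : 0 ≤ u₂) (hu₃ : 0 ≤ u₃)
    (hv₁ : 0 ≤ v₁) (hv₂ : 0 ≤ v₂) (hv₃ : 0 ≤ v₃) (ht : 0 ≤ t) (ht' : t ≤ 1)
    (has : as = g₁*g₂*g₃) (hcs₁ : cs₁ = g₂*g₃*(u₁+v₁)) (hcs₂ : cs₂ = g₁*g₃*(u₂+v₂)) (hcs₃ : cs₃ = g₁*g₂*(u₃+v₃))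
    (hbs : bs = (g₁+u₁+v₁)*(g₂+u₂+v₂)*(g₃+u₃+v₃) - g₁*g₂*g₃ - g₂*g₃*(u₁+v₁) - g₁*g₃*(u₂+v₂) - g₁*g₂*(u₃+v₃))
    (haw : aw = (g₁+u₁)*(g₂+u₂)*(g₃+u₃)) (hcw₁ : cw₁ = (g₂+u₂)*(g₃+u₃)*v₁) (hcw₂ : cw₂ = (g₁+u₁)*(g₃+u₃)*v₂) (hcw₃ : cw₃ = (g₁+u₁)*(g₂+u₂)*v₃)
    (hbw : bw = (g₁+u₁+v₁)*(g₂+u₂+v₂)*(g₃+u₃+v₃) - (g₁+u₁)*(g₂+u₂)*(g₃+u₃) - (g₂+u₂)*(g₃+u₃)*v₁ - (g₁+u₁)*(g₃+u₃)*v₂ - (g₁+u₁)*(g₂+u₂)*v₃)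
    (hb : b = (1-t)*bs + t*bw) (hc₁ : c₁ = (1-t)*cs₁ + t*cw₁) (hc₂ : c₂ = (1-t)*cs₂ + t*cw₂) (hc₃ : c₃ = (1-t)*cs₃ + t*cw₃)
    (ha : a = (1-t)*as + t*aw) :
    c₁*c₂*c₃ ≤ a*(a*b - (c₁*c₂+c₁*c₃+c₂*c₃)) := by
  have hE := nestedStar_LA_expand (as := as) (bs := bs) (cs₁ := cs₁) (cs₂ := cs₂) (cs₃ := cs₃) (aw := aw) (bw := bw) (cw₁ := cw₁)
    (cw₂ := cw₂) (cw₃ := cw₃) hb hc₁ hc₂ hc₃ ha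
  obtain ⟨h0, h1, -, -⟩ := nestedStar_ends has hcs₁ hcs₂ hcs₃ hbs haw hcw₁ hcw₂ hcw₃ hbw
  obtain ⟨B, hB0, hB⟩ := nestedStar_beta_eq hg₁ hg₂ hg₃ hu₁ hu₂ hu₃ hv₁ hv₂ hv₃ has hcs₁ hcs₂ hcs₃ hbs haw hcw₁ hcw₂ hcw₃ hbw
  obtain ⟨Mv, hM0, hM⟩ := nestedStar_M_eq hg₁ hg₂ hg₃ hu₁ hu₂ hu₃ hv₁ hv₂ hv₃ has hcs₁ hcs₂ hcs₃ hbs haw hcw₁ hcw₂ hcw₃ hbw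
  rw [h0, h1, hB, hM] at hE
  rw [← sub_nonneg, hE]
  have h1t : 0 ≤ 1 - t := by linarith only [ht']
  positivity

/-- `AG ≥ 0` along the pencil (Gladkov; here from the explicit expansion). [this work] -/
theorem nestedStar_AG_nonneg (hg₁ : 0 ≤ g₁) (hg₂ : 0 ≤ g₂) (hg₃ : 0 ≤ g₃) (hu₁ : 0 ≤ u₁) (hu₂ : 0 ≤ u₂) (hu₃ : 0 ≤ u₃)
    (hv₁ : 0 ≤ v₁) (hv₂ : 0 ≤ v₂) (hv₃ : 0 ≤ v₃) (ht : 0 ≤ t) (ht' : t ≤ 1)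
    (has : as = g₁*g₂*g₃) (hcs₁ : cs₁ = g₂*g₃*(u₁+v₁)) (hcs₂ : cs₂ = g₁*g₃*(u₂+v₂)) (hcs₃ : cs₃ = g₁*g₂*(u₃+v₃))
    (hbs : bs = (g₁+u₁+v₁)*(g₂+u₂+v₂)*(g₃+u₃+v₃) - g₁*g₂*g₃ - g₂*g₃*(u₁+v₁) - g₁*g₃*(u₂+v₂) - g₁*g₂*(u₃+v₃))
    (haw : aw = (g₁+u₁)*(g₂+u₂)*(g₃+u₃)) (hcw₁ : cw₁ = (g₂+u₂)*(g₃+u₃)*v₁) (hcw₂ : cw₂ = (g₁+u₁)*(g₃+u₃)*v₂) (hcw₃ : cw₃ = (g₁+u₁)*(g₂+u₂)*v₃)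
    (hbw : bw = (g₁+u₁+v₁)*(g₂+u₂+v₂)*(g₃+u₃+v₃) - (g₁+u₁)*(g₂+u₂)*(g₃+u₃) - (g₂+u₂)*(g₃+u₃)*v₁ - (g₁+u₁)*(g₃+u₃)*v₂ - (g₁+u₁)*(g₂+u₂)*v₃)
    (hb : b = (1-t)*bs + t*bw) (hc₁ : c₁ = (1-t)*cs₁ + t*cw₁) (hc₂ : c₂ = (1-t)*cs₂ + t*cw₂) (hc₃ : c₃ = (1-t)*cs₃ + t*cw₃)
    (ha : a = (1-t)*as + t*aw) :
    0 ≤ a*b - (c₁*c₂+c₁*c₃+c₂*c₃) := by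
  have hE := nestedStar_AG_expand (as := as) (bs := bs) (cs₁ := cs₁) (cs₂ := cs₂) (cs₃ := cs₃) (aw := aw) (bw := bw) (cw₁ := cw₁)
    (cw₂ := cw₂) (cw₃ := cw₃) hb hc₁ hc₂ hc₃ ha
  obtain ⟨-, -, h2, h3⟩ := nestedStar_ends has hcs₁ hcs₂ hcs₃ hbs haw hcw₁ hcw₂ hcw₃ hbw
  obtain ⟨X, hX0, h4⟩ := nestedStar_X_eq hg₁ hg₂ hg₃ hu₁ hu₂ hu₃ hv₁ hv₂ hv₃ has hcs₁ hcs₂ hcs₃ hbs haw hcw₁ hcw₂ hcw₃ hbw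
  rw [h2, h3, h4] at hE
  rw [hE]
  have h1t : 0 ≤ 1 - t := by linarith only [ht']
  positivity

/-- **THEOREM ((C1) on nested `PC* → PC*` pencils)**: `e₃(c) ≤ max(a,b)·(ab − e₂(c))`; hence (C1) for every structure
`[z=0: PC*(G); z=1: PC*(W)]` with `G_i ⊆ W_i` up-sets on disjoint blocks (any sizes, further free coins allowed). [this work] -/
theorem nestedStar_C1 (hg₁ : 0 ≤ g₁) (hg₂ : 0 ≤ g₂) (hg₃ : 0 ≤ g₃) (hu₁ : 0 ≤ u₁) (hu₂ : 0 ≤ u₂) (hu₃ : 0 ≤ u₃)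
    (hv₁ : 0 ≤ v₁) (hv₂ : 0 ≤ v₂) (hv₃ : 0 ≤ v₃) (ht : 0 ≤ t) (ht' : t ≤ 1)
    (has : as = g₁*g₂*g₃) (hcs₁ : cs₁ = g₂*g₃*(u₁+v₁)) (hcs₂ : cs₂ = g₁*g₃*(u₂+v₂)) (hcs₃ : cs₃ = g₁*g₂*(u₃+v₃))
    (hbs : bs = (g₁+u₁+v₁)*(g₂+u₂+v₂)*(g₃+u₃+v₃) - g₁*g₂*g₃ - g₂*g₃*(u₁+v₁) - g₁*g₃*(u₂+v₂) - g₁*g₂*(u₃+v₃))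
    (haw : aw = (g₁+u₁)*(g₂+u₂)*(g₃+u₃)) (hcw₁ : cw₁ = (g₂+u₂)*(g₃+u₃)*v₁) (hcw₂ : cw₂ = (g₁+u₁)*(g₃+u₃)*v₂) (hcw₃ : cw₃ = (g₁+u₁)*(g₂+u₂)*v₃)
    (hbw : bw = (g₁+u₁+v₁)*(g₂+u₂+v₂)*(g₃+u₃+v₃) - (g₁+u₁)*(g₂+u₂)*(g₃+u₃) - (g₂+u₂)*(g₃+u₃)*v₁ - (g₁+u₁)*(g₃+u₃)*v₂ - (g₁+u₁)*(g₂+u₂)*v₃)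
    (hb : b = (1-t)*bs + t*bw) (hc₁ : c₁ = (1-t)*cs₁ + t*cw₁) (hc₂ : c₂ = (1-t)*cs₂ + t*cw₂) (hc₃ : c₃ = (1-t)*cs₃ + t*cw₃)
    (ha : a = (1-t)*as + t*aw) :
    c₁*c₂*c₃ ≤ max a b * (a*b - (c₁*c₂+c₁*c₃+c₂*c₃)) := by
  have hA := nestedStar_LA_nonneg hg₁ hg₂ hg₃ hu₁ hu₂ hu₃ hv₁ hv₂ hv₃ ht ht' has hcs₁ hcs₂ hcs₃ hbs haw hcw₁ hcw₂ hcw₃ hbw hb hc₁ hc₂ hc₃ ha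
  have hAG := nestedStar_AG_nonneg hg₁ hg₂ hg₃ hu₁ hu₂ hu₃ hv₁ hv₂ hv₃ ht ht' has hcs₁ hcs₂ hcs₃ hbs haw hcw₁ hcw₂ hcw₃ hbw hb hc₁ hc₂ hc₃ ha
  have ha0 : 0 ≤ a := by
    have h1t : 0 ≤ 1 - t := by linarith only [ht']
    rw [ha, has, haw]; positivity
  have hmax : a ≤ max a b := le_max_left a b
  calc c₁*c₂*c₃ ≤ a*(a*b - (c₁*c₂+c₁*c₃+c₂*c₃)) := hA
    _ ≤ max a b * (a*b - (c₁*c₂+c₁*c₃+c₂*c₃)) := mul_le_mul_of_nonneg_right hmax hAG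

end Pencil

end NestedStarPencil

end Summit.CriticalPhenomena.PercolationContinuityZ3.Theorems.SunflowerPartition
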